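import Summits.HubbardSuperconductivity.HubbardLadder.Bounds.FdcHoist
import HarnessLib

/-!
# Bridge: the closed-form FDC energy of the circuit `F31` equals the integer evaluator

HONEST FRAMING: ladder R1–R4 with certified numbers; no claim on H/H₀; bounds for model classes,
no materials claim.

For spin ½ (`q = 2`) the positions `P = (ℤ/2ℤ)²` and the cluster / plaquette configurations
`P → Fin 2` are identified with `Fin 4` and `Fin 16` (`posEquiv`, `cfgEquiv`); the normalised
cluster vector `phiHat = v/‖v‖` and the unitary `uHat = UI/SCALE` of `FdcEval2x2` are transported,
`‖phiHat‖ = 1` and `uHatᴴ uHat = 1` are proved from the kernel facts `N2_eq`, `UI_orthogonal`, and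
the `ℂ`-valued cluster factors of `FdcTwoTilingEnergy` are identified with the integer tables:
`fdcS = SIlit/N2`, `fdcD = DIlit/N2` (part `FdcEvalSums` continues with the conjugated plaquette
operators, the contraction sums and the energy formula). [folklore]
-/

namespace Summit.HubbardSuperconductivity.HubbardLadder.Bounds

open Matrix Finset Complex
open Literature.Probability.LatticeModels Literature.MathematicalPhysics.QuantumLattice

noncomputable section

/-! ### Positions `(ℤ/2ℤ)² ≃ Fin 4` and configurations `Fin 16 ≃ (P → Fin 2)` -/

/-- `δ ↦ δ₀ + 2 δ₁`. [folklore] -/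
def posEquiv : FdcP ≃ Fin 4 :=
  (finFunctionFinEquiv (m := 2) (n := 2)).trans (finCongr (by norm_num))

/-- `j ↦ (δ ↦ bit (posEquiv δ) of j)`. [folklore] -/
def cfgEquiv : Fin 16 ≃ TensorIndex FdcP 2 :=
  ((finFunctionFinEquiv (m := 2) (n := 4)).symm.trans (posEquiv.symm.arrowCongr (Equiv.refl _)) :
    Fin (2 ^ 4) ≃ (FdcP → Fin 2))

/-- [folklore] -/
theorem cfgEquiv_apply (j : Fin 16) (p : FdcP) : cfgEquiv j p = fbit (posEquiv p) j := by
  apply Fin.ext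
  simp only [cfgEquiv, Equiv.trans_apply, Equiv.arrowCongr_apply, Equiv.symm_symm, Equiv.coe_refl,
    Function.comp_apply, id_eq, fbit]
  rfl

/-- [folklore] -/
theorem posEquiv_symm_apply_eq_zero_iff : ∀ (m : Fin 4) (i : Fin 2),
    posEquiv.symm m i = 0 ↔ pbit i m = 0 := by
  decide +kernel

/-- [folklore] -/
theorem posEquiv_symm_add_single : ∀ (m : Fin 4) (i : Fin 2),
    posEquiv (posEquiv.symm m + Pi.single i 1) = pflip i m := by
  decide +kernel

/-- [folklore] -/
theorem posEquiv_apply_eq_zero_iff (p : FdcP) (i : Fin 2) : p i = 0 ↔ pbit i (posEquiv p) = 0 := by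
  simpa using posEquiv_symm_apply_eq_zero_iff (posEquiv p) i

/-- [folklore] -/
theorem posEquiv_add_single (p : FdcP) (i : Fin 2) :
    posEquiv (p + Pi.single i 1) = pflip i (posEquiv p) := by
  simpa using posEquiv_symm_add_single (posEquiv p) i

/-- [folklore] -/
theorem forall_ne_fbit_iff : ∀ (m₀ : Fin 4) (j j' : Fin 16),
    (∀ m : Fin 4, m ≠ m₀ → fbit m j = fbit m j') ↔ agree1 m₀ j j' = true := by
  decide +kernel

/-- [folklore] -/
theorem forall_ne_ne_fbit_iff : ∀ (m₀ m₁ : Fin 4) (j j' : Fin 16),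
    (∀ m : Fin 4, m ≠ m₀ → m ≠ m₁ → fbit m j = fbit m j') ↔ agree2 m₀ m₁ j j' = true := by
  decide +kernel

/-- Sums over configurations as sums over `Fin 16`. [folklore] -/
theorem sum_cfg (F : TensorIndex FdcP 2 → ℂ) : (∑ l, F l) = ∑ j : Fin 16, F (cfgEquiv j) :=
  (Equiv.sum_comp cfgEquiv F).symm

/-- Products over positions as products over `Fin 4`. [folklore] -/
theorem prod_pos (G : FdcP → ℂ) : (∏ δ, G δ) = ∏ m : Fin 4, G (posEquiv.symm m) :=
  (Equiv.prod_comp posEquiv.symm G).symm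

/-- Entries of a one-site operator in the `Fin 16` coordinates. [folklore] -/
theorem onSite_cfgEquiv (p : FdcP) (s : Matrix (Fin 2) (Fin 2) ℂ) (j j' : Fin 16) :
    onSite p s (cfgEquiv j) (cfgEquiv j') =
      if agree1 (posEquiv p) j j' = true then s (fbit (posEquiv p) j) (fbit (posEquiv p) j')
      else 0 := by
  have hiff : (∀ y : FdcP, y ≠ p → fbit (posEquiv y) j = fbit (posEquiv y) j') ↔
      agree1 (posEquiv p) j j' = true := by
    rw [← forall_ne_fbit_iff]
    constructor
    · intro h m hm
      have := h (posEquiv.symm m) fun e => hm (by rw [← e, Equiv.apply_symm_apply])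
      simpa only [Equiv.apply_symm_apply] using this
    · intro h y hy
      exact h (posEquiv y) fun e => hy (posEquiv.injective e)
  simp only [onSite_apply, cfgEquiv_apply, hiff]

/-- Entries of a product of one-site operators at distinct positions in the `Fin 16` coordinates.
[folklore] -/
theorem onSite_mul_onSite_cfgEquiv {p p' : FdcP} (hpp : p ≠ p') (s s' : Matrix (Fin 2) (Fin 2) ℂ)
    (j j' : Fin 16) :
    (onSite p s * onSite p' s') (cfgEquiv j) (cfgEquiv j') =
      if agree2 (posEquiv p) (posEquiv p') j j' = true then
        s (fbit (posEquiv p) j) (fbit (posEquiv p) j') *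
          s' (fbit (posEquiv p') j) (fbit (posEquiv p') j')
      else 0 := by
  have hiff : (∀ z : FdcP, z ≠ p → z ≠ p' → fbit (posEquiv z) j = fbit (posEquiv z) j') ↔
      agree2 (posEquiv p) (posEquiv p') j j' = true := by
    rw [← forall_ne_ne_fbit_iff]
    constructor
    · intro h m hm hm'
      have := h (posEquiv.symm m) (fun e => hm (by rw [← e, Equiv.apply_symm_apply]))
        (fun e => hm' (by rw [← e, Equiv.apply_symm_apply]))
      simpa only [Equiv.apply_symm_apply] using this
    · intro h z hz hz'
      exact h (posEquiv z) (fun e => hz (posEquiv.injective e)) fun e => hz' (posEquiv.injective e)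
  simp only [onSite_mul_onSite_apply hpp, cfgEquiv_apply, hiff]

/-- Integer one-site entries, cast. [folklore] -/
theorem osI_cast (m : Fin 4) (s : Fin 2 → Fin 2 → ℤ) (j j' : Fin 16) :
    ((osI m s j j' : ℤ) : ℂ) = if agree1 m j j' = true then ((s (fbit m j) (fbit m j') : ℤ) : ℂ)
      else 0 := by
  unfold osI; split_ifs <;> simp

/-- Integer two-site entries, cast. [folklore] -/
theorem os2I_cast (m : Fin 4) (s : Fin 2 → Fin 2 → ℤ) (m' : Fin 4) (s' : Fin 2 → Fin 2 → ℤ)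
    (j j' : Fin 16) :
    ((os2I m s m' s' j j' : ℤ) : ℂ) = if agree2 m m' j j' = true then
      ((s (fbit m j) (fbit m j') : ℤ) : ℂ) * ((s' (fbit m' j) (fbit m' j') : ℤ) : ℂ) else 0 := by
  unfold os2I; split_ifs <;> simp

/-- The matrix unit is the cast of `unitI`. [folklore] -/
theorem single_eq_unitI_cast (a a' b b' : Fin 2) :
    single a a' (1 : ℂ) b b' = ((unitI a a' b b' : ℤ) : ℂ) := by
  rw [show single a a' (1 : ℂ) b b' = if a = b ∧ a' = b' then 1 else 0 from rfl, unitI]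
  by_cases h : b = a ∧ b' = a'
  · rw [if_pos ⟨h.1.symm, h.2.symm⟩, if_pos h]; simp
  · rw [if_neg (fun h' => h ⟨h'.1.symm, h'.2.symm⟩), if_neg h]; simp

/-! ### The transported cluster vector and plaquette unitary -/

/-- The cluster vector `v` in configuration coordinates. [folklore] -/
def vC : TensorIndex FdcP 2 → ℂ := fun l => ((vI (cfgEquiv.symm l) : ℤ) : ℂ)

/-- **The normalised cluster vector** `v / ‖v‖` of the circuit `F31`. [folklore] -/
def phiHat : TensorIndex FdcP 2 → ℂ := ((Real.sqrt N2 : ℝ) : ℂ)⁻¹ • vC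

/-- The integer circuit in configuration coordinates. [folklore] -/
def UC : Op FdcP 2 := of fun l l' => ((UI (cfgEquiv.symm l) (cfgEquiv.symm l') : ℤ) : ℂ)

/-- **The plaquette unitary** `UI / SCALE` of the circuit `F31`. [folklore] -/
def uHat : Op FdcP 2 := ((SCALE : ℕ) : ℂ)⁻¹ • UC

/-- An integer `2 × 2` table as a complex matrix. [folklore] -/
def castM (s : Fin 2 → Fin 2 → ℤ) : Matrix (Fin 2) (Fin 2) ℂ := of fun a b => ((s a b : ℤ) : ℂ)

/-- [folklore] -/
theorem vC_cfgEquiv (j : Fin 16) : vC (cfgEquiv j) = ((vI j : ℤ) : ℂ) := by simp [vC]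

/-- [folklore] -/
theorem UC_cfgEquiv (j j' : Fin 16) : UC (cfgEquiv j) (cfgEquiv j') = ((UI j j' : ℤ) : ℂ) := by
  simp [UC]

/-- [folklore] -/
theorem castM_apply (s : Fin 2 → Fin 2 → ℤ) (a b : Fin 2) : castM s a b = ((s a b : ℤ) : ℂ) := rfl

/-- `(N2 : ℂ) ≠ 0`; `private` (file-internal: the dedup checker matches its printed form with an
unrelated landed lemma; `FdcEvalSums` carries its own private copy). [folklore] -/
private theorem N2_cast_ne_zero : (N2 : ℂ) ≠ 0 := by norm_num [N2]

/-- `(SCALE : ℂ) ≠ 0`; `private` for the same reason. [folklore] -/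
private theorem SCALE_cast_ne_zero : (SCALE : ℂ) ≠ 0 := by norm_num [SCALE]

/-- [folklore] -/
theorem sqrtN2_inv_mul (x : ℂ) :
    ((Real.sqrt N2 : ℝ) : ℂ)⁻¹ * (((Real.sqrt N2 : ℝ) : ℂ)⁻¹ * x) = x / (N2 : ℂ) := by
  rw [← mul_assoc, ← mul_inv, ← Complex.ofReal_mul, Real.mul_self_sqrt (Nat.cast_nonneg _),
    Complex.ofReal_natCast, div_eq_inv_mul]

/-- [folklore] -/
theorem SCALE_inv_mul (x : ℂ) :
    ((SCALE : ℕ) : ℂ)⁻¹ * ((((SCALE : ℕ) : ℂ)⁻¹) * x) = x / (SCALE : ℂ) ^ 2 := by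
  rw [← mul_assoc, ← mul_inv, ← pow_two, div_eq_inv_mul]

/-- `‖phiHat‖ = 1`. [folklore] -/
theorem star_phiHat_dotProduct_phiHat : star phiHat ⬝ᵥ phiHat = 1 := by
  have hcore : star vC ⬝ᵥ vC = (N2 : ℂ) := by
    simp only [dotProduct, Pi.star_apply, sum_cfg, vC_cfgEquiv, star_intCast]
    have h := congrArg (fun z : ℤ => (z : ℂ)) N2_eq
    push_cast at h
    exact h
  unfold phiHat
  rw [star_smul, smul_dotProduct, dotProduct_smul, hcore, smul_eq_mul, smul_eq_mul, Complex.star_def,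
    map_inv₀, Complex.conj_ofReal, sqrtN2_inv_mul, div_self N2_cast_ne_zero]

/-- `UCᵀ UC = SCALE² · 1`. [folklore] -/
theorem conjTranspose_UC_mul_UC : UCᴴ * UC = ((SCALE : ℂ) ^ 2) • (1 : Op FdcP 2) := by
  ext l l'
  obtain ⟨j, rfl⟩ := cfgEquiv.surjective l
  obtain ⟨j', rfl⟩ := cfgEquiv.surjective l'
  rw [Matrix.mul_apply, sum_cfg]
  simp only [conjTranspose_apply, UC_cfgEquiv, star_intCast, Matrix.smul_apply, Matrix.one_apply,
    EmbeddingLike.apply_eq_iff_eq, smul_eq_mul, mul_ite, mul_one, mul_zero]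
  have h := congrArg (fun z : ℤ => (z : ℂ)) (UI_orthogonal j j')
  push_cast at h
  rw [h]

/-- **`uHat` is unitary.** [folklore] -/
theorem conjTranspose_uHat_mul_uHat : uHatᴴ * uHat = 1 := by
  unfold uHat
  rw [conjTranspose_smul, Matrix.smul_mul, Matrix.mul_smul, conjTranspose_UC_mul_UC, smul_smul,
    smul_smul, Complex.star_def, map_inv₀, map_natCast]
  rw [show ((SCALE : ℕ) : ℂ)⁻¹ * ((SCALE : ℕ) : ℂ)⁻¹ * (SCALE : ℂ) ^ 2 = 1 by
    rw [mul_assoc, SCALE_inv_mul, div_self (pow_ne_zero _ SCALE_cast_ne_zero)], one_smul]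

/-! ### Cluster factors -/

/-- [folklore] -/
theorem star_vC_onSite_vC (p : FdcP) (a a' : Fin 2) :
    star vC ⬝ᵥ (onSite p (single a a' (1 : ℂ)) *ᵥ vC) = ((SIdir (posEquiv p) a a' : ℤ) : ℂ) := by
  simp only [dotProduct, mulVec, Pi.star_apply, sum_cfg, vC_cfgEquiv, star_intCast, onSite_cfgEquiv,
    single_eq_unitI_cast]
  push_cast [SIdir, osI_cast]
  rfl

/-- **One-point cluster factors** of `phiHat`. [folklore] -/
theorem fdcS_phiHat (p : FdcP) (a a' : Fin 2) :
    fdcS phiHat p a a' = ((SIlit (posEquiv p) a a' : ℤ) : ℂ) / (N2 : ℂ) := by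
  unfold fdcS phiHat
  rw [mulVec_smul, star_smul, smul_dotProduct, dotProduct_smul, star_vC_onSite_vC,
    ← SIdir_eq_lit (posEquiv p) a a', smul_eq_mul, smul_eq_mul, Complex.star_def, map_inv₀,
    Complex.conj_ofReal, sqrtN2_inv_mul]

/-- [folklore] -/
theorem star_vC_onSite_onSite_vC (p p' : FdcP) (a a' c c' : Fin 2) :
    star vC ⬝ᵥ (onSite p (single a a' (1 : ℂ)) *ᵥ (onSite p' (single c c' (1 : ℂ)) *ᵥ vC)) =
      ((DIdir (posEquiv p) a a' (posEquiv p') c c' : ℤ) : ℂ) := by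
  simp only [dotProduct, mulVec, Pi.star_apply, sum_cfg, vC_cfgEquiv, star_intCast, onSite_cfgEquiv,
    single_eq_unitI_cast]
  push_cast [DIdir, osI_cast]
  rfl

/-- **Two-point cluster factors** of `phiHat` (adjacent positions). [folklore] -/
theorem fdcD_phiHat (p : FdcP) (i : Fin 2) (hp : p i = 0) (a a' c c' : Fin 2) :
    fdcD phiHat p a a' (p + Pi.single i 1) c c' = ((DIlit i (posEquiv p) a a' c c' : ℤ) : ℂ) / (N2 : ℂ) := by
  unfold fdcD phiHat
  rw [mulVec_smul, mulVec_smul, star_smul, smul_dotProduct, dotProduct_smul, star_vC_onSite_onSite_vC,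
    posEquiv_add_single, DIdir_eq_DIdef,
    DIdef_eq_lit i (posEquiv p) a a' c c' ((posEquiv_apply_eq_zero_iff p i).1 hp),
    smul_eq_mul, smul_eq_mul, Complex.star_def, map_inv₀, Complex.conj_ofReal, sqrtN2_inv_mul]

end

end Summit.HubbardSuperconductivity.HubbardLadder.Bounds
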